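import Literature.Geometry.Lorentzian.KerrStarLaplacianPair
import Literature.Analysis.SpecialFunctions.PolarSphereGreen
import HarnessLib

/-!
# Green's identity for the Kerr-star angular slices: `⟪F, Δ̸F⟫_𝓗 = -‖∇̸F‖²`

Dafermos–Rodnianski–Shlapentokh-Rothman, arXiv:1402.7034, §5.3: after Plancherel the eigenvalue
weight `Σ λ_{mℓ} |u|²` is the physical-space quantity `∫ |∇̸Ψ|²` (up to the `ν² cos²θ` term).
`KerrStarPlancherel.lean` reduced the frequency side to `-Re ⟪û, 𝓕(Δ̸F)⟫`; by the polarised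
Plancherel in time this is `-∫_t Re ⟪F(t, r, ·), Δ̸F(t, r, ·)⟫_𝓗 dt`, and this file computes the
integrand in coordinates (`PolarSphereGreen.inner_polarLp_laplacian` applied to the slices of
`F = Φ ∘ κ_a`):

* `Kerr.norm_starChart_sq`, `Kerr.exists_abs_dir_three_le` (`|∂_{φ*}F| ≤ C |sin θ|` on a slice:
  `κ_*∂_φ = sin θ · (r φ̂ + a ∂_φφ̂)`);
* **`Kerr.inner_sliceFn_sliceLap`**: for `Φ ∈ C²(ℝ⁴)` and `r > 0`,
  `⟪𝓛F|_{t,r}, 𝓛(Δ̸F)|_{t,r}⟫ =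
    -(1/2π) (∫_0^π∫_0^{2π} sin θ (∂_θF)² + ∫_0^π (∫_0^{2π} (∂_φF)²)/sin θ)`,
  and the same for the `𝓗`-valued slices `angSlice` (`Kerr.inner_angSlice_sphLaplacianStar`).

## References

* M. Dafermos, I. Rodnianski, Y. Shlapentokh-Rothman, arXiv:1402.7034, §5.3.
  [DafermosRodnianskiShlapentokhrothman2014]
-/

noncomputable section

open Real Set Filter MeasureTheory Function
open scoped Topology InnerProductSpace ComplexConjugate

namespace Literature.Geometry.Lorentzian

namespace Kerr

open Literature.Analysis.SpecialFunctions Literature.Analysis.FunctionSpaces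
  Literature.Analysis.Fourier

/-! ### Norm bounds for the chart -/

/-- `‖κ_a(q)‖² = t*² + r² + a² sin²θ`. [folklore] -/
theorem norm_starChart_sq (a : ℝ) (q : E4) :
    ‖starChart a q‖ ^ 2 = q 0 ^ 2 + (q 1 ^ 2 + a ^ 2 * sin (q 2) ^ 2) := by
  rw [EuclideanSpace.norm_sq_eq, Fin.sum_univ_four, starChart_eq_toLp]
  simp only [Real.norm_eq_abs, sq_abs, Matrix.cons_val_zero, Matrix.cons_val_one,
    Matrix.cons_val]
  have hθ := sin_sq_add_cos_sq (q 2)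
  have hφ := sin_sq_add_cos_sq (q 3)
  linear_combination (sin (q 2) ^ 2 * (q 1 ^ 2 + a ^ 2)) * hφ + q 1 ^ 2 * hθ

/-- The slice `{(t*, r)} × S²` lies in the ball of radius `√(t*² + r² + a²)`. [folklore] -/
theorem norm_starChart_starq_le (a t r θ φ : ℝ) :
    ‖starChart a (starq t r θ φ)‖ ≤ Real.sqrt (t ^ 2 + r ^ 2 + a ^ 2) := by
  refine Real.le_sqrt_of_sq_le ?_
  rw [norm_starChart_sq, starq_apply_zero, starq_apply_one, starq_apply_two]
  nlinarith [sin_sq_le_one θ, sq_nonneg a]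

/-- `‖φ̂‖ = 1`. [folklore] -/
theorem norm_sphAzimuth (φ : ℝ) : ‖sphAzimuth φ‖ = 1 := by
  have h : ‖sphAzimuth φ‖ ^ 2 = 1 := by
    rw [E3.norm_sq]; simp [sin_sq_add_cos_sq]
  nlinarith [norm_nonneg (sphAzimuth φ)]

/-- `‖∂_φφ̂‖ = 1`. [folklore] -/
theorem norm_sphHoriz (φ : ℝ) : ‖sphHoriz φ‖ = 1 := by
  have h : ‖sphHoriz φ‖ ^ 2 = 1 := by
    rw [E3.norm_sq]; simp [cos_sq_add_sin_sq]
  nlinarith [norm_nonneg (sphHoriz φ)]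

/-- **`|∂_{φ*}F| ≤ C |sin θ|` on a slice** (`F = Φ ∘ κ_a`, `Φ ∈ C¹`): the coordinate field
`∂_{φ*}` vanishes on the axis to first order. [folklore] -/
theorem exists_abs_dir_three_le (a : ℝ) {Φ : E4 → ℝ} (hΦ : ContDiff ℝ 1 Φ) (t r : ℝ) :
    ∃ C : ℝ, ∀ θ φ, |dir 3 (starPull a Φ) (starq t r θ φ)| ≤ C * |sin θ| := by
  obtain ⟨B, hB⟩ := (isCompact_closedBall (0 : E4) (Real.sqrt (t ^ 2 + r ^ 2 + a ^ 2)))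
    |>.exists_bound_of_continuousOn (hΦ.continuous_fderiv one_ne_zero).continuousOn
  refine ⟨B * ‖E4.spaceEmbed‖ * (|r| + |a|), fun θ φ ↦ ?_⟩
  have hx : starChart a (starq t r θ φ) ∈ Metric.closedBall (0 : E4)
      (Real.sqrt (t ^ 2 + r ^ 2 + a ^ 2)) := by
    rw [Metric.mem_closedBall, dist_zero_right]
    exact norm_starChart_starq_le a t r θ φ
  have hBx := hB _ hx
  have hB0 : 0 ≤ B := (norm_nonneg _).trans hBx
  rw [dir_apply, fderiv_starPull (hΦ.differentiable one_ne_zero _) 3, starFrame_three,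
    starq_apply_one, starq_apply_two, starq_apply_three, map_smul, map_smul, smul_eq_mul, abs_mul,
    mul_comm]
  refine mul_le_mul_of_nonneg_right ?_ (abs_nonneg _)
  calc |fderiv ℝ Φ (starChart a (starq t r θ φ))
        (E4.spaceEmbed (r • sphAzimuth φ + a • sphHoriz φ))|
      ≤ ‖fderiv ℝ Φ (starChart a (starq t r θ φ))‖ *
          ‖E4.spaceEmbed (r • sphAzimuth φ + a • sphHoriz φ)‖ := by
        rw [← Real.norm_eq_abs]; exact ContinuousLinearMap.le_opNorm _ _
    _ ≤ B * (‖E4.spaceEmbed‖ * ‖r • sphAzimuth φ + a • sphHoriz φ‖) := by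
        gcongr
        exact ContinuousLinearMap.le_opNorm _ _
    _ ≤ B * (‖E4.spaceEmbed‖ * (|r| + |a|)) := by
        gcongr
        calc ‖r • sphAzimuth φ + a • sphHoriz φ‖ ≤ ‖r • sphAzimuth φ‖ + ‖a • sphHoriz φ‖ :=
              norm_add_le _ _
          _ = |r| + |a| := by
              rw [norm_smul, norm_smul, norm_sphAzimuth, norm_sphHoriz, Real.norm_eq_abs,
                Real.norm_eq_abs, mul_one, mul_one]
    _ = B * ‖E4.spaceEmbed‖ * (|r| + |a|) := by ring

/-! ### Green's identity for the slices -/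

section Main

variable [h2π : Fact (0 < 2 * π)]

/-- **`⟪𝓛F, 𝓛(Δ̸F)⟫ = -(1/2π) (∫_0^π∫_0^{2π} sin θ (∂_θF)² + ∫_0^π (∫_0^{2π} (∂_φF)²)/sin θ)`**
on the slice `(t*, r)`, `r > 0`, for `F = Φ ∘ κ_a`, `Φ ∈ C²`.
[cite: DafermosRodnianskiShlapentokhrothman2014, §5.3] -/
theorem inner_sliceFn_sliceLap (a : ℝ) {Φ : E4 → ℝ} (hΦ : ContDiff ℝ 2 Φ) {t r : ℝ} (hr : 0 < r) :
    ⟪polarLp (2 * π) (sliceFn a Φ t r) (continuous_sliceFn a t r hΦ),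
        polarLp (2 * π) (sliceLap a Φ t r) (continuous_sliceLap a t r hΦ)⟫_ℂ =
      -((1 / (2 * π) : ℝ) : ℂ) *
        ((∫ θ in (0 : ℝ)..π, ∫ φ in (0 : ℝ)..2 * π,
            (sin θ : ℂ) * ((dir 2 (starPull a Φ) (starq t r θ φ) ^ 2 : ℝ) : ℂ)) +
          ∫ θ in (0 : ℝ)..π, (∫ φ in (0 : ℝ)..2 * π,
            ((dir 3 (starPull a Φ) (starq t r θ φ) ^ 2 : ℝ) : ℂ)) / (sin θ : ℂ)) := by
  set F : E4 → ℝ := starPull a Φ with hFdef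
  have hF : ContDiff ℝ 2 F := hΦ.comp (contDiff_starChart a)
  have hFd : ∀ q, DifferentiableAt ℝ F q := fun q ↦ hF.differentiable two_ne_zero q
  set e₂ : E4 := E4.basisVector 2
  set e₃ : E4 := E4.basisVector 3
  set g : ℝ → ℝ → ℂ := sliceFn a Φ t r with hgdef
  set gθ : ℝ → ℝ → ℂ := fun θ φ ↦ (fderiv ℝ F (starq t r θ φ) e₂ : ℂ) with hgθdef
  set w : ℝ → ℝ → ℂ := fun θ φ ↦ ((cos θ * fderiv ℝ F (starq t r θ φ) e₂ +
    sin θ * fderiv ℝ (fderiv ℝ F) (starq t r θ φ) e₂ e₂ : ℝ) : ℂ) with hwdef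
  set gφ : ℝ → ℝ → ℂ := fun θ φ ↦ (fderiv ℝ F (starq t r θ φ) e₃ : ℂ) with hgφdef
  set gφφ : ℝ → ℝ → ℂ := fun θ φ ↦ (fderiv ℝ (fderiv ℝ F) (starq t r θ φ) e₃ e₃ : ℂ) with hgφφdef
  set h : ℝ → ℝ → ℂ := fun θ φ ↦ -sliceLap a Φ t r θ φ with hhdef
  have hgθ : ∀ θ φ, HasDerivAt (fun θ ↦ g θ φ) (gθ θ φ) θ := fun θ φ ↦
    (hasDerivAt_comp_starq_theta t r θ φ (hFd _)).ofReal_comp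
  have hw : ∀ θ φ, HasDerivAt (fun θ ↦ (sin θ : ℂ) * gθ θ φ) (w θ φ) θ := by
    intro θ φ
    have h1 := (hasDerivAt_sin θ).mul (hasDerivAt_fderiv_comp_starq_theta hF t r θ φ e₂)
    have h2 := h1.ofReal_comp
    have hfun : (fun θ ↦ (sin θ : ℂ) * gθ θ φ) =
        fun y ↦ ((sin y * fderiv ℝ F (starq t r y φ) e₂ : ℝ) : ℂ) := by
      funext y
      rw [hgθdef]
      push_cast
      ring
    rw [hfun]
    refine h2.congr_deriv ?_
    rw [hwdef]
  have hgφ : ∀ θ φ, HasDerivAt (g θ) (gφ θ φ) φ := fun θ φ ↦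
    (hasDerivAt_comp_starq_phi t r θ φ (hFd _)).ofReal_comp
  have hgφφ : ∀ θ φ, HasDerivAt (gφ θ) (gφφ θ φ) φ := fun θ φ ↦
    (hasDerivAt_fderiv_comp_starq_phi hF t r θ φ e₃).ofReal_comp
  have hcg : Continuous (Function.uncurry g) := continuous_sliceFn a t r hΦ
  have hcgθ : Continuous (Function.uncurry gθ) :=
    Complex.continuous_ofReal.comp (continuous_fderiv_comp_starq hF two_ne_zero t r e₂)
  have hcw : Continuous (Function.uncurry w) := by
    refine Complex.continuous_ofReal.comp ?_
    exact ((continuous_cos.comp continuous_fst).mul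
      (continuous_fderiv_comp_starq hF two_ne_zero t r e₂)).add
      ((continuous_sin.comp continuous_fst).mul (continuous_fderiv_fderiv_comp_starq hF t r e₂ e₂))
  have hcgφ : Continuous (Function.uncurry gφ) :=
    Complex.continuous_ofReal.comp (continuous_fderiv_comp_starq hF two_ne_zero t r e₃)
  have hcgφφ : Continuous (Function.uncurry gφφ) :=
    Complex.continuous_ofReal.comp (continuous_fderiv_fderiv_comp_starq hF t r e₃ e₃)
  have hch : Continuous (Function.uncurry h) := (continuous_sliceLap a t r hΦ).neg
  have hper : ∀ θ φ, g θ (φ + 2 * π) = g θ φ := by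
    intro θ φ
    rw [hgdef, sliceFn_apply, sliceFn_apply, starq_add_phi, starPull_add_two_pi]
  have hperφ : ∀ θ φ, gφ θ (φ + 2 * π) = gφ θ φ := by
    intro θ φ
    simp only [hgφdef]
    rw [starq_add_phi, hFdef, fderiv_starPull_add_two_pi]
  have hrel : ∀ θ φ, (sin θ : ℂ) ^ 2 * h θ φ = -(sin θ : ℂ) * w θ φ - gφφ θ φ := by
    intro θ φ
    by_cases hs : sin θ = 0
    · have hconst : ∀ φ', F (starq t r θ φ') = F (starq t r θ 0) := fun φ' ↦ by
        rw [hFdef, starPull_apply, starPull_apply, starChart_starq_of_sin_eq_zero a hs φ',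
          starChart_starq_of_sin_eq_zero a hs 0]
      have h3 : ∀ φ', fderiv ℝ F (starq t r θ φ') e₃ = 0 := fun φ' ↦ by
        have hd := hasDerivAt_comp_starq_phi t r θ φ' (hFd _)
        have hc : HasDerivAt (fun φ'' ↦ F (starq t r θ φ'')) 0 φ' := by
          have : (fun φ'' ↦ F (starq t r θ φ'')) = fun _ ↦ F (starq t r θ 0) := funext hconst
          rw [this]
          exact hasDerivAt_const _ _
        exact hd.unique hc
      have h33 : fderiv ℝ (fderiv ℝ F) (starq t r θ φ) e₃ e₃ = 0 := by
        have hd := hasDerivAt_fderiv_comp_starq_phi hF t r θ φ e₃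
        have hc : HasDerivAt (fun φ' ↦ fderiv ℝ F (starq t r θ φ') e₃) 0 φ := by
          have : (fun φ' ↦ fderiv ℝ F (starq t r θ φ') e₃) = fun _ ↦ (0 : ℝ) := funext h3
          rw [this]
          exact hasDerivAt_const _ _
        exact hd.unique hc
      rw [hgφφdef]
      simp only [hs, h33, Complex.ofReal_zero]
      ring
    · have hq1 : 0 < starq t r θ φ 1 := by rwa [starq_apply_one]
      have hq2 : sin (starq t r θ φ 2) ≠ 0 := by rwa [starq_apply_two]
      have hreal : sin θ ^ 2 * (-sphLaplacianStar a Φ (starq t r θ φ)) =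
          -sin θ * (cos θ * fderiv ℝ F (starq t r θ φ) e₂ +
            sin θ * fderiv ℝ (fderiv ℝ F) (starq t r θ φ) e₂ e₂) -
            fderiv ℝ (fderiv ℝ F) (starq t r θ φ) e₃ e₃ := by
        rw [sphLaplacianStar_eq hq1 hq2 hΦ.contDiffAt, starq_apply_two]
        field_simp
        ring
      rw [hhdef, hwdef, hgφφdef]
      simp only [sliceLap_apply]
      exact_mod_cast hreal
  -- the bound on `∂_φ F`
  obtain ⟨C, hC⟩ := exists_abs_dir_three_le a (hΦ.of_le one_le_two) t r
  have hb : ∀ θ φ, ‖gφ θ φ‖ ≤ C * |sin θ| := fun θ φ ↦ by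
    rw [hgφdef]
    simp only [Complex.norm_real, Real.norm_eq_abs]
    exact hC θ φ
  have hgreen := inner_polarLp_laplacian (T := 2 * π) hgθ hw hgφ hgφφ hcg hcgθ hcw hcgφ hcgφφ hch
    hper hperφ hrel hb
  rw [show polarLp (2 * π) h hch =
      -polarLp (2 * π) (sliceLap a Φ t r) (continuous_sliceLap a t r hΦ)
    from polarLp_neg _ (continuous_sliceLap a t r hΦ) hch, inner_neg_right] at hgreen
  rw [neg_eq_iff_eq_neg.1 hgreen, neg_mul]
  congr 2
  · congr 1
    · refine intervalIntegral.integral_congr fun θ _ ↦ ?_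
      refine intervalIntegral.integral_congr fun φ _ ↦ ?_
      simp only [hgθdef, Complex.conj_ofReal, dir_apply]
      push_cast
      ring
    · refine intervalIntegral.integral_congr fun θ _ ↦ ?_
      congr 1
      refine intervalIntegral.integral_congr fun φ _ ↦ ?_
      simp only [hgφdef, Complex.conj_ofReal, dir_apply]
      push_cast
      ring

/-- The same for the `𝓗`-valued slices `angSlice`. [folklore] -/
theorem inner_angSlice_sphLaplacianStar (a : ℝ) {Φ : E4 → ℝ} (hΦ : ContDiff ℝ 2 Φ) {t r : ℝ}
    (hr : 0 < r) :
    ⟪angSlice (starPull a Φ) (hΦ.comp (contDiff_starChart a)).continuous t r,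
        angSlice (sphLaplacianStar a Φ) (continuous_sphLaplacianStar a hΦ) t r⟫_ℂ =
      -((1 / (2 * π) : ℝ) : ℂ) *
        ((∫ θ in (0 : ℝ)..π, ∫ φ in (0 : ℝ)..2 * π,
            (sin θ : ℂ) * ((dir 2 (starPull a Φ) (starq t r θ φ) ^ 2 : ℝ) : ℂ)) +
          ∫ θ in (0 : ℝ)..π, (∫ φ in (0 : ℝ)..2 * π,
            ((dir 3 (starPull a Φ) (starq t r θ φ) ^ 2 : ℝ) : ℂ)) / (sin θ : ℂ)) :=
  inner_sliceFn_sliceLap a hΦ hr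

end Main

end Kerr

end Literature.Geometry.Lorentzian
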